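import Literature.MathematicalPhysics.QuantumFieldTheory.Balaban1983to89.B6SectACriticalPointV1
import HarnessLib

/-!
# Route `UnitScaleTilt`, crux K1 child «MinimiserStabilityRegPr» (stmt-QuantumFields-19200), leaf V2′ `stub_halvingStep` — PILLAR F3′
# (k-LEVEL FLAT OPERATORS, located finding F-p1g15-1 / UV3-NODE §24), FILE 2: **PRINT'S `H` OF (45)/(157) AND `G̃ = G − HQG` OF (143)/(158)
# FOR AN ARBITRARY NESTED DOMAIN FAMILY — INCLUDING THE CUBE SEQUENCE (144) WITH ITS LEVEL-0 ANNULUS — BY NAME, WITH THEIR EXACT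
# ALGEBRA**: `Q(HB) = B` (45), the Landau condition `R∂*(HB) = 0` (45), `QG̃ = 0` («Q𝔊 = 0», p. 294), `Δ_aH = Q*(QGQ*)⁻¹`,
# `Δ_aG̃ = 1 − Q*(QGQ*)⁻¹QG` (= «GP₀*», p. 300), the Δ_a-ORTHOGONALITY of `H` to `ker Q`, the Δ_a-EQUATION of `G̃` on `ker Q`, symmetry of
# `(QGQ*)⁻¹` and `G̃`, and CANONICITY: `H` and `G̃` do NOT depend on the auxiliary weights `a` of `Δ_a` (p. 228 «The only assumption we
# have used was the positivity of the operator Δ_a, a > 0»)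

Cell `ym3-torus` (HUMAN RULING D-0037, YM ladder rung R3), seat `ym3-torus-p1` gen 15.  `--supports stmt-QuantumFields-19200 --as helper`;
count-neutral; def-free (the operators are lit-balaban p21/r03's `B6SectAVectorModelV1.GE` = `G = Δ_a⁻¹`, `EE` = `(QGQ*)⁻¹`, `B6SectAOperatorsV1.QE`/`QsE`
= the multi-scale `Q`/`Q*` (2.20), `RE` (2.10)–(2.12), and r03's `B6SectA.hOp G Q* E = GQ*(QGQ*)⁻¹` (2.35) — for EVERY `D : B6SectADomainsV1.Domains P`,
so in particular for the cube sequence `FlatCubeSequence.cubeSeq` of file 1 (p527555) and for the one-level family `Domains.whole`).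

WHY (UV3-NODE §24; F4 pen PROGRESS 3 «DECISION MEMO» concurring).  [Balaban1985Variational] Sect. F runs the chart (47) and the equation (158) with
the MULTI-LEVEL `H` (157) and `G̃` (158) of the cube sequence (144); the F4 pen's geometry-agnostic parts 5–7 (`FlatCriticalEquation143.eq143_of_critical`,
`FlatSmallSolution158Levels`, `FlatChart47Levels`) consume, besides the ANALYTIC letters (gap G-F3′-L0), the following EXACT ALGEBRA of the pair `(H, G̃)`:
a linear right inverse `Q ∘ H = id`, `Q ∘ G̃ = 0`, `Δ_a` positive with `G = Δ_a⁻¹`, and `H` Δ_a-orthogonal to `ker Q` (their `hHorth`).  This file supplies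
that algebra at the Setup torus for every nested family, from p21's kernel-checked Sect. A — so «print's `H` and `G̃` for the cube family» are
citable objects with their identities TODAY; only the estimates remain.

WHAT IS PROVED (sorry-free; axioms standard; every `D : Domains P`, lattice factor `c ≠ 0`, weights `w > 0`; `H := hOp (GE D hc hw) (QsE D) (EE D hc hw)`,
`G̃ := GE D hc hw − H ∘ₗ QE D ∘ₗ GE D hc hw` written out).
* §1 `H`: `hOp_apply`, **`QE_hOp`** / `QE_comp_hOp` ((45) `LʲηQ_jHB = B on Λ_j` — all levels at once), **`RE_dsE_hOp`** ((45) `R∂*HB = 0`, from r03/p21's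
  Faddeev–Popov identity (2.34)), `deltaAE_hOp` (`Δ_aHB = Q*(QGQ*)⁻¹B`), **`inner_deltaAE_hOp_eq_zero`** (`Qδ = 0 ⇒ ⟨δ, Δ_aHB⟩ = 0`), and by name p21's
  `isCritical_hOp_V1` / `energy_hOp_le_V1` (criticality and minimality of `HB` for `½‖∂A‖²` on `{QA = B, R∂*A = 0}`, p. 285 «giving a minimum of the
  quadratic form ½⟨A, ΔA⟩ under the restrictions …»).
* §2 `G̃`: **`QE_Gt`** («Q𝔊 = 0»), `deltaAE_Gt` (`Δ_aG̃f = f − Q*(QGQ*)⁻¹QGf`), **`inner_deltaAE_Gt_of_ker`** (`Qδ = 0 ⇒ ⟨δ, Δ_aG̃f⟩ = ⟨δ, f⟩`: `G̃` inverts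
  `Δ_a` ON `ker Q` in the weak sense), `inner_deltaAE_right_of_ker` (on `ker Q` the form of `Δ_a` is `⟨∂·,∂·⟩ + ⟨∂*·, R∂*·⟩`, WEIGHT-FREE),
  **`eq_Gt_of_ker`** (uniqueness: the weak equation on `ker Q` characterises `G̃f`).
* §3 symmetry: `inner_qgqE_left`, **`inner_EE_left`** (`(QGQ*)⁻¹` symmetric), **`inner_Gt_left`** (`G̃` symmetric).
* §4 CANONICITY: **`hOp_eq_hOp`** and **`Gt_eq_Gt`** — for two weight families `w, w′ > 0` the operators `H`, `G̃` COINCIDE (p. 228).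
* §5 **`exists_flatOps`** — the pair `(H, G̃)` packaged with all of the above + criticality/minimality (one citation for the composer).
HONEST SCOPE.  Finite-dimensional linear algebra over p21/r03's certified Sect. A; no estimate ([Balaban1984PropagatorsII] Prop. 2.2/2.7/Cor. 2.8 for families with
`Λ₀ ≠ ∅` = gap G-F3′-L0).  Which `D` (cube sequence, one level) the assembly feeds is its choice.  NOT a claim about the mass gap.

References: T. Bałaban, CMP **102** (1985) 277–309 [Balaban1985Variational] (45)–(46) p.285, (129)–(131) p.297, (143) p.300, (157)–(158) p.302, p.294 («Q𝔊 = 0»);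
CMP **96** (1984) 223–250 [Balaban1984PropagatorsII] (2.19)–(2.22) p.226, (2.31) p.227, (2.34)–(2.35) p.228.
-/

set_option autoImplicit false

noncomputable section

open scoped InnerProductSpace

namespace Summit.QuantumFields.YangMills.Theorems.FlatCubeOperators

open Literature.MathematicalPhysics.QuantumFieldTheory.Balaban1983to89
open Literature.MathematicalPhysics.QuantumFieldTheory.BalabanImbrieJaffe1984to88.BIJ85AxialPropagator411 (BondSpace)
open B6SectADomainsV1 (Domains)
open B6SectAOperatorsV1 (BondIdx BondIdxSpace QE QsE RE dsE dcE dE inner_QsE_left)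
open B6SectAVectorModelV1 (deltaAE GE EE deltaAE_GE GE_deltaAE inner_GE_left inner_deltaAE_right inner_deltaAE_left comp_EE
  eq_zero_of_inner_deltaAE_self_eq_zero)
open B6SectACriticalPointV1 (eq234_left_V1 isCritical_hOp_V1 isCritical_iff_eq_hOp energy_hOp_le_V1)
open B6Eq218Lagrangian (IsCritical Admissible energy)
open B6SectA (hOp)

variable {P : Params} (D : Domains P) {c : ℝ} (hc : c ≠ 0) {w : BondIdx D → ℝ} (hw : ∀ i, 0 < w i)

/-! ## §1 `H = GQ*(QGQ*)⁻¹`: (45) and its Δ_a-orthogonality to `ker Q` -/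

/-- unfolding r03's `hOp`: `HB = G(Q*((QGQ*)⁻¹B))`. [cite: Balaban1984PropagatorsII, (2.35) p.228] -/
theorem hOp_apply (B : BondIdxSpace D) : hOp (GE D hc hw) (QsE D) (EE D hc hw) B = GE D hc hw (QsE D (EE D hc hw B)) := rfl

/-- **(45) `Q(HB) = B`** — the multi-level constraints (2.6)/(2.20) at ALL levels `j = 0, …, k` at once (`Q₀ = id` on the level-0 region).
[cite: Balaban1985Variational, (45) p.285; Balaban1984PropagatorsII, (2.35) p.228] -/
theorem QE_hOp (B : BondIdxSpace D) : QE D (hOp (GE D hc hw) (QsE D) (EE D hc hw) B) = B :=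
  LinearMap.congr_fun (comp_EE D hc hw) B

/-- (45) as an operator identity: `Q ∘ H = id`. [cite: Balaban1985Variational, (45) p.285] -/
theorem QE_comp_hOp : QE D ∘ₗ hOp (GE D hc hw) (QsE D) (EE D hc hw) = LinearMap.id :=
  LinearMap.ext (QE_hOp D hc hw)

/-- **(45) `R∂*(HB) = 0`** — the Landau condition of print's `H`, from the Faddeev–Popov identity (2.34) `R∂*GQ* = 0` (r03/p21).
[cite: Balaban1985Variational, (45) p.285; Balaban1984PropagatorsII, (2.34) p.228] -/
theorem RE_dsE_hOp (B : BondIdxSpace D) : RE D c (dsE c (hOp (GE D hc hw) (QsE D) (EE D hc hw) B)) = 0 := by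
  have h := LinearMap.congr_fun (eq234_left_V1 D hc hw) (EE D hc hw B)
  simpa [hOp] using h

/-- `Δ_a(HB) = Q*((QGQ*)⁻¹B)` (`Δ_aG = 1`). [cite: Balaban1984PropagatorsII, (2.22) p.226, (2.35) p.228] -/
theorem deltaAE_hOp (B : BondIdxSpace D) : deltaAE D c w (hOp (GE D hc hw) (QsE D) (EE D hc hw) B) = QsE D (EE D hc hw B) := by
  rw [hOp_apply, deltaAE_GE]

/-- **`H` IS Δ_a-ORTHOGONAL TO `ker Q`**: `Qδ = 0 ⇒ ⟨δ, Δ_a(HB)⟩ = 0` — the hypothesis `hHorth` of the F4 pen's `FlatCriticalEquation143.eq143_of_critical`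
(print p. 297: `H₀ = GQ*(QGQ*)⁻¹` is the Δ_a-orthogonal right inverse of `Q`). [cite: Balaban1985Variational, (129)-(131) p.297; Balaban1984PropagatorsII, (2.35) p.228] -/
theorem inner_deltaAE_hOp_eq_zero {δ : BondSpace P} (hδ : QE D δ = 0) (B : BondIdxSpace D) :
    ⟪δ, deltaAE D c w (hOp (GE D hc hw) (QsE D) (EE D hc hw) B)⟫_ℝ = 0 := by
  rw [deltaAE_hOp, real_inner_comm, inner_QsE_left, hδ, inner_zero_right]

/-! ## §2 `G̃ = G − HQG`: «Q𝔊 = 0» and the weak Δ_a-equation on `ker Q` -/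

/-- **«Q𝔊 = 0»**: `Q(G̃f) = 0` for `G̃ = G − HQG` ((143): `GP₀* = G − GQ*(QGQ*)⁻¹QG = G̃`). [cite: Balaban1985Variational, (143) p.300, p.294 («Q𝔊 = 0»)] -/
theorem QE_Gt (f : BondSpace P) :
    QE D ((GE D hc hw - hOp (GE D hc hw) (QsE D) (EE D hc hw) ∘ₗ QE D ∘ₗ GE D hc hw) f) = 0 := by
  simp only [LinearMap.sub_apply, LinearMap.comp_apply, map_sub, QE_hOp, sub_self]

/-- `Δ_a(G̃f) = f − Q*((QGQ*)⁻¹(Q(Gf)))` (print: `Δ_aG̃ = P₀*`). [cite: Balaban1985Variational, (131) p.297, (143) p.300] -/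
theorem deltaAE_Gt (f : BondSpace P) :
    deltaAE D c w ((GE D hc hw - hOp (GE D hc hw) (QsE D) (EE D hc hw) ∘ₗ QE D ∘ₗ GE D hc hw) f) =
      f - QsE D (EE D hc hw (QE D (GE D hc hw f))) := by
  simp only [LinearMap.sub_apply, LinearMap.comp_apply, map_sub, deltaAE_GE, deltaAE_hOp]

/-- **THE WEAK Δ_a-EQUATION OF `G̃` ON `ker Q`**: `Qδ = 0 ⇒ ⟨δ, Δ_a(G̃f)⟩ = ⟨δ, f⟩` — `G̃` inverts `Δ_a` on the constraint surface
(the content of «A₀ = −𝔊(…)» solving the constrained critical-point equation, p. 294/300). [cite: Balaban1985Variational, (131)-(133) p.297-299, (143) p.300] -/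
theorem inner_deltaAE_Gt_of_ker {δ : BondSpace P} (hδ : QE D δ = 0) (f : BondSpace P) :
    ⟪δ, deltaAE D c w ((GE D hc hw - hOp (GE D hc hw) (QsE D) (EE D hc hw) ∘ₗ QE D ∘ₗ GE D hc hw) f)⟫_ℝ = ⟪δ, f⟫_ℝ := by
  rw [deltaAE_Gt, inner_sub_right, ← deltaAE_hOp D hc hw (QE D (GE D hc hw f)), inner_deltaAE_hOp_eq_zero D hc hw hδ, sub_zero]

/-- ON `ker Q` THE FORM OF `Δ_a` IS WEIGHT-FREE: `Qx = 0 ⇒ ⟨x, Δ_ay⟩ = ⟨∂x, ∂y⟩ + ⟨∂*x, R∂*y⟩` (the `Q*aQ` term drops).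
[cite: Balaban1984PropagatorsII, (2.18)-(2.19) p.226] -/
theorem inner_deltaAE_right_of_ker {x : BondSpace P} (hx : QE D x = 0) (y : BondSpace P) :
    ⟪x, deltaAE D c w y⟫_ℝ = ⟪dcE c x, dcE c y⟫_ℝ + ⟪dsE c x, RE D c (dsE c y)⟫_ℝ := by
  rw [inner_deltaAE_right, hx, inner_zero_left, add_zero]

/-- **UNIQUENESS / CHARACTERISATION OF `G̃f`**: an `x ∈ ker Q` with `⟨δ, Δ_ax⟩ = ⟨δ, f⟩` for all `δ ∈ ker Q` IS `G̃f` (positivity of `Δ_a` on the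
difference). [cite: Balaban1984PropagatorsII, (2.19)-(2.22) p.226; Balaban1985Variational, (143) p.300] -/
theorem eq_Gt_of_ker (f x : BondSpace P) (hx : QE D x = 0) (h : ∀ δ : BondSpace P, QE D δ = 0 → ⟪δ, deltaAE D c w x⟫_ℝ = ⟪δ, f⟫_ℝ) :
    x = (GE D hc hw - hOp (GE D hc hw) (QsE D) (EE D hc hw) ∘ₗ QE D ∘ₗ GE D hc hw) f := by
  set y := (GE D hc hw - hOp (GE D hc hw) (QsE D) (EE D hc hw) ∘ₗ QE D ∘ₗ GE D hc hw) f with hy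
  have hyk : QE D y = 0 := QE_Gt D hc hw f
  have hdk : QE D (x - y) = 0 := by rw [map_sub, hx, hyk, sub_zero]
  have h0 : ⟪x - y, deltaAE D c w (x - y)⟫_ℝ = 0 := by
    rw [map_sub, inner_sub_right, h (x - y) hdk, hy, inner_deltaAE_Gt_of_ker D hc hw hdk f, sub_self]
  have := eq_zero_of_inner_deltaAE_self_eq_zero D hc hw h0
  exact sub_eq_zero.1 this

/-! ## §3 Symmetry of `(QGQ*)⁻¹` and of `G̃` -/

/-- `QGQ*` is symmetric. [cite: Balaban1984PropagatorsII, p.228 before (2.35)] -/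
theorem inner_qgqE_left (a b : BondIdxSpace D) :
    ⟪QE D (GE D hc hw (QsE D a)), b⟫_ℝ = ⟪a, QE D (GE D hc hw (QsE D b))⟫_ℝ := by
  rw [real_inner_comm, ← inner_QsE_left, real_inner_comm, inner_GE_left, ← inner_QsE_left, real_inner_comm]

/-- **`(QGQ*)⁻¹` IS SYMMETRIC** (inverse of a symmetric operator). [cite: Balaban1984PropagatorsII, p.228 before (2.35)] -/
theorem inner_EE_left (a b : BondIdxSpace D) : ⟪EE D hc hw a, b⟫_ℝ = ⟪a, EE D hc hw b⟫_ℝ := by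
  have hb : QE D (GE D hc hw (QsE D (EE D hc hw b))) = b := LinearMap.congr_fun (comp_EE D hc hw) b
  have ha : QE D (GE D hc hw (QsE D (EE D hc hw a))) = a := LinearMap.congr_fun (comp_EE D hc hw) a
  conv_lhs => rw [← hb]
  conv_rhs => rw [← ha]
  rw [← inner_qgqE_left]

/-- **`G̃` IS SYMMETRIC**. [cite: Balaban1985Variational, (143) p.300; Balaban1984PropagatorsII, (2.35) p.228] -/
theorem inner_Gt_left (u v : BondSpace P) :
    ⟪(GE D hc hw - hOp (GE D hc hw) (QsE D) (EE D hc hw) ∘ₗ QE D ∘ₗ GE D hc hw) u, v⟫_ℝ =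
      ⟪u, (GE D hc hw - hOp (GE D hc hw) (QsE D) (EE D hc hw) ∘ₗ QE D ∘ₗ GE D hc hw) v⟫_ℝ := by
  simp only [LinearMap.sub_apply, LinearMap.comp_apply, hOp_apply, inner_sub_left, inner_sub_right]
  rw [inner_GE_left D hc hw u v]
  congr 1
  -- `⟨GQ*E(QGu), v⟩ = ⟨E(QGu), QGv⟩ = ⟨QGu, E(QGv)⟩ = ⟨u, GQ*E(QGv)⟩`
  rw [inner_GE_left, inner_QsE_left, inner_EE_left, real_inner_comm, ← inner_QsE_left, ← inner_GE_left, real_inner_comm]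

/-! ## §4 Canonicity: `H` and `G̃` do not depend on the weights `a` -/

/-- **`H` IS CANONICAL**: for two weight families `w, w′ > 0` the operators `GQ*(QGQ*)⁻¹` COINCIDE (both are the unique critical configuration of (2.5)
under (2.6), (2.12); p. 228 «The only assumption we have used was the positivity of the operator Δ_a, a > 0»). [cite: Balaban1984PropagatorsII, (2.35) p.228] -/
theorem hOp_eq_hOp {w' : BondIdx D → ℝ} (hw' : ∀ i, 0 < w' i) (B : BondIdxSpace D) :
    hOp (GE D hc hw) (QsE D) (EE D hc hw) B = hOp (GE D hc hw') (QsE D) (EE D hc hw') B :=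
  (isCritical_iff_eq_hOp D hc hw' B _).1 (isCritical_hOp_V1 D hc hw B)

/-- **`G̃` IS CANONICAL**: for two weight families `w, w′ > 0` the operators `G − HQG` COINCIDE (both solve the weight-free weak equation on `ker Q`).
[cite: Balaban1985Variational, (143) p.300; Balaban1984PropagatorsII, (2.19) p.226] -/
theorem Gt_eq_Gt {w' : BondIdx D → ℝ} (hw' : ∀ i, 0 < w' i) (f : BondSpace P) :
    (GE D hc hw - hOp (GE D hc hw) (QsE D) (EE D hc hw) ∘ₗ QE D ∘ₗ GE D hc hw) f =
      (GE D hc hw' - hOp (GE D hc hw') (QsE D) (EE D hc hw') ∘ₗ QE D ∘ₗ GE D hc hw') f := by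
  refine eq_Gt_of_ker D hc hw' f _ (QE_Gt D hc hw f) fun δ hδ => ?_
  rw [inner_deltaAE_right_of_ker D hδ, ← inner_deltaAE_right_of_ker D (w := w) hδ]
  exact inner_deltaAE_Gt_of_ker D hc hw hδ f

/-! ## §5 One-stop export: print's `(H, G̃)` for the family `D` with their algebra -/

/-- **PRINT'S FLAT `H` (45)/(157) AND `G̃` (143)/(158) FOR THE NESTED FAMILY `D`, PACKAGED**: linear operators `H : L²(𝔅) → L²(bonds)`,
`G̃ : L²(bonds) → L²(bonds)` (equal to r03/p21's `GQ*(QGQ*)⁻¹` and `G − HQG`) with: `Q ∘ H = id` (45), `Q ∘ G̃ = 0` («Q𝔊 = 0»), the Landau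
condition `R∂*(HB) = 0` (45), Δ_a-orthogonality of `H` to `ker Q`, the weak Δ_a-equation of `G̃` on `ker Q`, symmetry of `G̃`, and criticality +
minimality of `HB` for (2.5) under (2.6), (2.12) (p. 285 «giving a minimum of the quadratic form … under the restrictions LʲηQ_jA = B on Λ_j,
RD*A = 0»).  For `D := FlatCubeSequence.cubeSeq …` these are the operators of [Balaban1985Variational] Sect. F (157)–(158); their ESTIMATES are gap G-F3′-L0.
[cite: Balaban1985Variational, (45) p.285, (143) p.300, (157)-(158) p.302; Balaban1984PropagatorsII, (2.35) p.228] -/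
theorem exists_flatOps :
    ∃ (H : BondIdxSpace D →ₗ[ℝ] BondSpace P) (Gt : BondSpace P →ₗ[ℝ] BondSpace P),
      (∀ B, H B = hOp (GE D hc hw) (QsE D) (EE D hc hw) B) ∧
      (∀ f, Gt f = GE D hc hw f - H (QE D (GE D hc hw f))) ∧
      QE D ∘ₗ H = LinearMap.id ∧
      QE D ∘ₗ Gt = 0 ∧
      (∀ B, RE D c (dsE c (H B)) = 0) ∧
      (∀ (δ : BondSpace P) (B : BondIdxSpace D), QE D δ = 0 → ⟪δ, deltaAE D c w (H B)⟫_ℝ = 0) ∧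
      (∀ (δ f : BondSpace P), QE D δ = 0 → ⟪δ, deltaAE D c w (Gt f)⟫_ℝ = ⟪δ, f⟫_ℝ) ∧
      (∀ u v : BondSpace P, ⟪Gt u, v⟫_ℝ = ⟪u, Gt v⟫_ℝ) ∧
      (∀ B, IsCritical (dcE c) (QE D) (dsE c) (RE D c) B (H B)) ∧
      (∀ (B : BondIdxSpace D) (y : BondSpace P), Admissible (QE D) (dsE c) (RE D c) B y → energy (dcE c) (H B) ≤ energy (dcE c) y) := by
  refine ⟨hOp (GE D hc hw) (QsE D) (EE D hc hw), GE D hc hw - hOp (GE D hc hw) (QsE D) (EE D hc hw) ∘ₗ QE D ∘ₗ GE D hc hw,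
    fun B => rfl, fun f => rfl, QE_comp_hOp D hc hw, LinearMap.ext (QE_Gt D hc hw), RE_dsE_hOp D hc hw,
    fun δ B hδ => inner_deltaAE_hOp_eq_zero D hc hw hδ B, fun δ f hδ => inner_deltaAE_Gt_of_ker D hc hw hδ f, inner_Gt_left D hc hw,
    isCritical_hOp_V1 D hc hw, fun B y hy => energy_hOp_le_V1 D hc hw B hy⟩

end Summit.QuantumFields.YangMills.Theorems.FlatCubeOperators

end
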